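import Mathlib.Topology.Algebra.Category.ProfiniteGrp.Basic
import Mathlib.GroupTheory.Index
import Mathlib.GroupTheory.Torsion
import Mathlib.GroupTheory.GroupAction.ConjAct
import Literature.AnabelianGeometry.AbsoluteAnabelian.FundamentalExtension
import Literature.AnabelianGeometry.EtaleTheta.CyclotomicEnvelope
import Literature.AnabelianGeometry.Anabelioids.ProSigma
import HarnessLib

/-!
# [AbsTopII] §3: pro-`Σ` elliptic cuspidalization (Example 3.2, Corollary 3.3, Remarks 3.3.2–3.3.3)

S. Mochizuki, *Topics in Absolute Anabelian Geometry II: Decomposition Groups and Endomorphisms*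
[AbsTopII], §3 "Elliptic and Belyi Cuspidalizations", pp. 66–69; §0 "Topological Groups" p. 5
(`G ⋊^out H`).  Page locators `p.N` are the PDF pages of the author's manuscript (lit key
`paper:url-585b8d0ad0d9`, 76 pp.); the journal pagination is not held.  Bib key
`MochizukiAbsTopII2013`.  Census nodes typed here: AbsTopII:Ex3.2(i), Ex3.2(ii), Cor3.3(i),
Cor3.3(iii), Rmk3.3.2, Rmk3.3.3 (Def 3.1 / Def 3.5 / Cor 3.3 (ii) are in
`AbsTopII/EllipticAdmissible.lean`; Cor 3.7 in the Belyi-cuspidalization sequel).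

## How the items are typed (cell ruling θ, shape (1): OUTPUT STRUCTURES over an abstract extension)

Corollary 3.3 describes a "group-theoretic algorithm" which, from an extension
`1 → Δ → Π → G → 1` (the tree's `FundamentalExtension`, abc-iut-L4-t1) satisfying HYPOTHESES
phrased in the vocabulary of [AbsTopI] §2/§4 — "`𝒟` chain-full, rel-isom-DGC holds" (Def 4.6
(i)(ii)), "extension of GSAFG-type admitting partial construction data `(k, X, Σ)`",
"scheme-theoretic envelope `α`" (Def 2.1 (iii)(iv)), the categories `Chain(Π)`,
`Chain^{iso-trm}(Π)`, `ÉtLoc(Π)` (Def 4.2), "`l`-cyclotomically full" — CONSTRUCTS the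
cuspidalization `Π_{U_X} ↠ Π` of `Π` at the `N`-torsion points.  Those hypotheses are owned by
abc-iut-L4-t4 (`AbsTopI/Chains.lean`) and abc-iut-L4-t13 (`RelativeGrothendieckConjecture.lean`:
`RelIsomDGC`, `IsChainFull`) and are not in the tree yet (-- TODO-import); they are needed only
for the shape-(M) EXISTENCE/COMPARISON statements (Cor 3.4; sequel file).  What is typed HERE is
the OUTPUT: `EllipticCuspidalization E` = the data (i), (ii), (iii) (a)(b)(c) produce, with every
printed group-theoretic property a field, over an ABSTRACT `E`; consumers take it as a hypothesis
BY NAME.  REAL and PROVED here: the type-chains of Example 3.2 (`ElementaryOp`,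
`Ex_3_2_i_typeChain`, `Ex_3_2_ii_typeChain`); the `⋊^out`-reconstruction principle behind clause
(iii)(b) and §0 p. 5 — for a normal subgroup `N ⊴ P` with trivial centre, `p ↦ (conj_p|_N, p̄)`
identifies `P` with `Aut(N) ×_{Out(N)} (P/N) = N ⋊^out (P/N)` (`conjProdQuot_injective`,
`mem_range_conjProdQuot_iff`; abstract `Out` = the tree's `EtaleTheta.Out`, the profinite topology
of §0 p. 5 forgotten; cf. `SemiGraphs.outerSemidirectProduct`, [SemiAnbd] §0).

Deliberately NOT here: Rmk 3.3.1, Rmk 3.3.4, Cor 3.4 (not census nodes; Rmk 3.3.1 and the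
comparison form Cor 3.4 go with Cor 3.7/3.8 in the sequel); the `ÉtLoc(Π')`-terminality clause of
Cor 3.3 (i) ([AbsTopI] Def 4.2 vocabulary — recorded in the docstring of `EllipticCuspidalization`).
HONEST FRAMING: typed ≠ discharged; nothing here takes a side on [IUTchIII] Cor 3.12.
-/

open CategoryTheory Topology

universe u

namespace Literature.AnabelianGeometry.AbsoluteAnabelian.AbsTopII

open Literature.AnabelianGeometry.Anabelioids (IsSigmaInteger)
open Literature.AnabelianGeometry.EtaleTheta (Out innerAut)
open FundamentalExtension

/-! ### Elementary operations and the type-chains of Example 3.2 -/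

/-- The symbols of a *type-chain* ([AbsTopI] Def 4.2, as used in [AbsTopII] Ex 3.2 p. 66):
`cov` = "⋏" a finite étale covering, `quot` = "⋎" a finite étale quotient, `decusp` = "•" a
de-cuspidalization.  (The fourth elementary operation "⊚", de-orbification, does not occur in
§3.)  -- TODO-import abc-iut-L4-t4 AbsTopI/Chains.lean (Def 4.2) when it lands.
[cite: MochizukiAbsTopII2013, Ex 3.2 (i) p.66] -/
inductive ElementaryOp : Type
  /-- "⋏": finite étale covering -/
  | cov
  /-- "⋎": finite étale quotient -/
  | quot
  /-- "•": de-cuspidalization -/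
  | decusp
  deriving DecidableEq

/-- **Example 3.2 (i)** p. 66: for `[N]_E : E → E` ("a finite étale covering `[N]_D : U → D` [of
degree `N²`], together with an open embedding `U ↪ D`") the chain
`D ⇝ U ⇝ U_n ⇝ U_{n−1} ⇝ ⋯ ⇝ U_1 = D`, "[where `n := N² − 1`] whose associated type-chain is
`⋏, •, …, •` [i.e., a finite étale covering, followed by `n` de-cuspidalizations]".
[cite: MochizukiAbsTopII2013, Ex 3.2 (i) p.66] -/
def Ex_3_2_i_typeChain (N : ℕ) : List ElementaryOp :=
  ElementaryOp.cov :: List.replicate (N ^ 2 - 1) ElementaryOp.decusp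

/-- **Example 3.2 (ii)** p. 67: appending "`V → X`, followed by [...] `V → D` on the left, and
[...] `V → D`, followed by [...] `V → X` on the right, we obtain a chain [...] whose associated
type-chain is `⋏, ⋎, ⋏, •, …, •, ⋏, ⋎`" — the type-chain quoted in Cor 3.3 (iii) (a).
[cite: MochizukiAbsTopII2013, Ex 3.2 (ii) p.67] -/
def Ex_3_2_ii_typeChain (N : ℕ) : List ElementaryOp :=
  [ElementaryOp.cov, ElementaryOp.quot] ++ Ex_3_2_i_typeChain N ++
    [ElementaryOp.cov, ElementaryOp.quot]

/-- The chain of Ex 3.2 (i) consists of one `⋏` followed by `n = N² − 1` symbols `•`.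
[cite: MochizukiAbsTopII2013, Ex 3.2 (i) p.66] -/
theorem length_Ex_3_2_i_typeChain (N : ℕ) : (Ex_3_2_i_typeChain N).length = 1 + (N ^ 2 - 1) := by
  simp [Ex_3_2_i_typeChain, Nat.add_comm]

/-- The chain of Ex 3.2 (ii) has length `n + 5`, `n = N² − 1`.
[cite: MochizukiAbsTopII2013, Ex 3.2 (ii) p.67] -/
theorem length_Ex_3_2_ii_typeChain (N : ℕ) :
    (Ex_3_2_ii_typeChain N).length = (N ^ 2 - 1) + 5 := by
  simp [Ex_3_2_ii_typeChain, Ex_3_2_i_typeChain]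

/-- For the `2`-torsion (`N = 2`) the chain of Ex 3.2 (i) is `⋏, •, •, •` (three
de-cuspidalizations: `E[2] ∖ {O}` has three points). [cite: MochizukiAbsTopII2013, Ex 3.2 (i) p.66] -/
theorem Ex_3_2_i_typeChain_two :
    Ex_3_2_i_typeChain 2 = [ElementaryOp.cov, ElementaryOp.decusp, ElementaryOp.decusp,
      ElementaryOp.decusp] := by
  decide

/-! ### `G ⋊^out H` (§0 p. 5) and the reconstruction principle of Cor 3.3 (iii) (b) -/

section OuterSemidirect

variable {P : Type u} [Group P] (N : Subgroup P) [N.Normal]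

/-- `p ↦ (conj_p|_N, p mod N) : P → Aut(N) × (P/N)` — the map comparing `P` with
`N ⋊^out (P/N) := Aut(N) ×_{Out(N)} (P/N)` (§0 p. 5: "the profinite group obtained by pulling back
the natural exact sequence `1 → G → Aut(G) → Out(G) → 1`").
[cite: MochizukiAbsTopII2013, §0 p.5] -/
def conjProdQuot : P →* MulAut N × (P ⧸ N) :=
  MonoidHom.prod MulAut.conjNormal (QuotientGroup.mk' N)

/-- The outer action `P → Out(N)` by conjugation. [cite: MochizukiAbsTopII2013, §0 p.5] -/
def outerConj : P →* Out N := (QuotientGroup.mk' (innerAut N)).comp MulAut.conjNormal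

/-- Conjugation by an element of `N` is inner on `N`: `N ≤ Ker(P → Out(N))`, so the outer action
factors through the quotient `P/N` ("`H → Out(G)`", §0 p. 5). [cite: MochizukiAbsTopII2013, §0 p.5] -/
theorem le_ker_outerConj : N ≤ (outerConj N).ker := by
  intro n hn
  rw [MonoidHom.mem_ker, outerConj, MonoidHom.comp_apply, QuotientGroup.mk'_apply,
    QuotientGroup.eq_one_iff]
  exact ⟨⟨n, hn⟩, (MulAut.conjNormal_val (h := ⟨n, hn⟩)).symm⟩

/-- The outer action `P/N → Out(N)` ("`ρ : H → Out(G)`" of §0 p. 5, for `H = P/N`).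
[cite: MochizukiAbsTopII2013, §0 p.5] -/
def outerConjQuot : P ⧸ N →* Out N := QuotientGroup.lift N (outerConj N) (le_ker_outerConj N)

/-- §0 p. 5 / Cor 3.3 (iii) (b), the reconstruction principle (PROVED): if `N` has trivial centre
then `P → Aut(N) × (P/N)` is injective — `P` embeds in `N ⋊^out (P/N)` ("the injective [since
`G` is center-free!] homomorphism `G → Aut(G)`", [SemiAnbd] §0).
[cite: MochizukiAbsTopII2013, §0 p.5] -/
theorem conjProdQuot_injective (h : Subgroup.center N = ⊥) : Function.Injective (conjProdQuot N) := by
  rw [← MonoidHom.ker_eq_bot_iff, eq_bot_iff]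
  intro p hp
  rw [MonoidHom.mem_ker, conjProdQuot, MonoidHom.prod_apply, Prod.mk_eq_one] at hp
  obtain ⟨h1, h2⟩ := hp
  have hpN : p ∈ N := by
    rwa [QuotientGroup.mk'_apply, QuotientGroup.eq_one_iff] at h2
  have hc : (⟨p, hpN⟩ : N) ∈ Subgroup.center N := by
    rw [Subgroup.mem_center_iff]
    intro g
    apply Subtype.ext
    have hg := congrArg (fun φ : MulAut N => ((φ g : N) : P)) h1
    simp only [MulAut.conjNormal_apply, MulAut.one_apply] at hg
    change (g : P) * p = p * g
    calc (g : P) * p = p * g * p⁻¹ * p := by rw [hg]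
      _ = p * g := by group
  rw [h, Subgroup.mem_bot] at hc
  exact Subgroup.mem_bot.mpr (congrArg Subtype.val hc)

/-- §0 p. 5 / Cor 3.3 (iii) (b) (PROVED): the image of `P → Aut(N) × (P/N)` is exactly the fibre
product `Aut(N) ×_{Out(N)} (P/N) = N ⋊^out (P/N)`; with `conjProdQuot_injective`, a group `P`
with a centre-free normal subgroup `N` IS `N ⋊^out (P/N)` for the outer action by conjugation —
the sense in which "`Π_{U_X} ↠ Π` may be recovered from `Π_{U_V} ↠ Π_V` by forming the `⋊^out`".
[cite: MochizukiAbsTopII2013, Cor 3.3 (iii)(b) p.69] -/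
theorem mem_range_conjProdQuot_iff (x : MulAut N × (P ⧸ N)) :
    x ∈ (conjProdQuot N).range ↔ QuotientGroup.mk' (innerAut N) x.1 = outerConjQuot N x.2 := by
  constructor
  · rintro ⟨p, rfl⟩
    simp only [conjProdQuot, MonoidHom.prod_apply, outerConjQuot, QuotientGroup.mk'_apply,
      QuotientGroup.lift_mk]
    rfl
  · obtain ⟨a, q⟩ := x
    induction q using QuotientGroup.induction_on with
    | H p =>
      intro hx
      change QuotientGroup.mk' (innerAut N) a = outerConjQuot N (QuotientGroup.mk p) at hx
      rw [outerConjQuot, QuotientGroup.lift_mk, outerConj, MonoidHom.comp_apply, eq_comm,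
        QuotientGroup.mk'_eq_mk'] at hx
      obtain ⟨z, ⟨m, rfl⟩, hz⟩ := hx
      refine ⟨p * (m : P), ?_⟩
      simp only [conjProdQuot, MonoidHom.prod_apply]
      refine Prod.ext ?_ ?_
      · dsimp only
        rw [map_mul, MulAut.conjNormal_val]
        exact hz
      · dsimp only
        rw [map_mul, QuotientGroup.mk'_apply, QuotientGroup.mk'_apply,
          (QuotientGroup.eq_one_iff (m : P)).mpr m.2, mul_one]

end OuterSemidirect

section OuterLifting

variable {P A : Type u} [Group P] [Group A]

/-- For `f : P → A` (think `Π_{U_V} → Π'`, with image `Π_V`) a homomorphism `ρ : A →* Out(P)` is an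
*outer lifting along `f`* of the conjugation action when every `ρ(g)` is represented by an
automorphism `a` of `P` with `f (a x) = g · f(x) · g⁻¹` — "the [...] lifting [relative to
`Π_{U_V} ↠ Π_V`] of the outer action of the finite group `Π/Π_V` on `Π_V` to a group of outer
automorphisms of `Π_{U_V}`" (Cor 3.3 (iii) (b) p. 69; abstract `Out`, topology forgotten).
[cite: MochizukiAbsTopII2013, Cor 3.3 (iii)(b) p.69] -/
def IsOuterLifting (f : P →* A) (ρ : A →* Out P) : Prop :=
  ∀ g : A, ∃ a : MulAut P, (QuotientGroup.mk a : Out P) = ρ g ∧ ∀ x : P, f (a x) = g * f x * g⁻¹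

end OuterLifting

/-! ### Corollary 3.3 (Pro-`Σ` Elliptic Cuspidalization I: Algorithms) — the output -/

/-- **Corollary 3.3** pp. 67–69, OUTPUT STRUCTURE (shape (1)) over an abstract extension `E`
(= `1 → Δ' → Π' → G' → 1`, the given extension already restricted to the "sufficiently small"
normal open `G' ⊆ G` of (i)/(iii), "where 'sufficiently' depends only on `N`"): the data the
group-theoretic algorithm (i), (ii), (iii) (a)(b)(c) constructs, with the printed properties.
(i) the `k'`-core `Π' ⇝ Π_C`, "the unique chain of length 1 in `Chain(Π')`, with associated
type-chain `⋎`, such that the resulting object of `ÉtLoc(Π')` forms a terminal object of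
`ÉtLoc(Π')`" (the `ÉtLoc`-terminality is [AbsTopI] Def 4.2 vocabulary — TODO-import
abc-iut-L4-t4; recorded, not typed); (ii) `Π_D ⊆ Π_C` open of index `2` with `Π_D ∩ Δ_C`
torsion-free; (iii) `N` a `Σ`-integer, `Π_V ⊆ Π'` normal open with `Π_V ↪ Π_D`, the cuspidalizations
`Π_U ↠ Π_D` and `Π_{U_X} ↠ Π'` produced by (a) from a `Π`-chain of type `⋏, ⋎, ⋏, •, …, •, ⋏, ⋎`,
glued along `Π_{U_V}` ((a), last clause; (b), bracket), the unique-lifting and `⋊^out` clauses of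
(b), and (c) the decomposition groups of the removed points (`removedPointDecomposition`).
[cite: MochizukiAbsTopII2013, Cor 3.3 pp.67-69] -/
structure EllipticCuspidalization (E : FundamentalExtension.{u}) : Type (u + 1) where
  /-- (iii) the positive integer `N`, "a product of primes [perhaps with multiplicities] of `Σ`" -/
  N : ℕ
  /-- the set of primes `Σ` of the partial construction data `(k, X, Σ)` -/
  Sigma : Set ℕ
  /-- (iii) `N` is a `Σ`-integer -/
  N_isSigmaInteger : IsSigmaInteger Sigma N
  /-- (i) the extension `Π_C ↠ G'` of the `k'`-core `C` -/
  core : FundamentalExtension.{u}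
  /-- (i) the chain `Π' ⇝ Π_C` of type `⋎`: `Π'` is an open subgroup of `Π_C` over `G'` -/
  toCore : E ⟶ core
  /-- (i) `Π' ↪ Π_C`, `G' → G_C` open injective … -/
  toCore_isOpenInjective : toCore.IsOpenInjective
  /-- (i) … and over `G'` (`C` is a `k'`-core: same base field) -/
  toCore_gal_bijective : Function.Bijective toCore.gal
  /-- (ii) the open subgroup `Π_D ⊆ Π_C` of the double covering `D → C` … -/
  PiD : Subgroup core.arith
  /-- (ii) … open … -/
  isOpen_PiD : IsOpen (PiD : Set core.arith)
  /-- (ii) … "of index `2`" … -/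
  index_PiD : PiD.index = 2
  /-- (ii) … "such that `J ∩ Δ_C` is torsion-free [i.e., the covering [...] is a scheme]" -/
  torsionFree_PiD : IsMulTorsionFree ↥(PiD ⊓ core.geom)
  /-- (iii) `Π_V ⊆ Π'`, "a normal open subgroup" (`V → X` Galois) … -/
  PiV : Subgroup E.arith
  /-- (iii) … normal … -/
  normal_PiV : PiV.Normal
  /-- (iii) … open -/
  isOpen_PiV : IsOpen (PiV : Set E.arith)
  /-- (iii) "`V → D` arises from an open immersion `Π_V ↪ Π_D`" -/
  map_PiV_le : PiV.map toCore.arith.toMonoidHom ≤ PiD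
  /-- (iii)(a) the extension `1 → Δ_U → Π_U → G' → 1` of `U := D ∖ (N-torsion)` … -/
  cuspU : FundamentalExtension.{u}
  /-- (iii)(a) … with "the natural surjection `Π_U ↠ Π_D`", recovered "from the chain of •'s
  terminating at the third to last group" of the `Π`-chain of type `Ex_3_2_ii_typeChain N` -/
  projU : cuspU ⟶ core
  /-- (iii)(a) `Π_U ↠ Π_D`: the image is `Π_D` … -/
  range_projU : projU.arith.toMonoidHom.range = PiD
  /-- (iii)(a) … over the same Galois group -/
  projU_gal_bijective : Function.Bijective projU.gal
  /-- (iii) the extension `1 → Δ_{U_X} → Π_{U_X} → G' → 1` … -/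
  cuspUX : FundamentalExtension.{u}
  /-- (iii) … with THE OUTPUT: "the natural surjection `Π_{U_X} ↠ Π` — i.e., 'cuspidalization'
  of `Π`" -/
  proj : cuspUX ⟶ E
  /-- `Π_{U_X} ↠ Π'` is surjective … -/
  proj_arith_surjective : Function.Surjective proj.arith
  /-- … and over the same Galois group `G'` -/
  proj_gal_bijective : Function.Bijective proj.gal
  /-- (iii)(a)/(b) "`Π_{U_V} ↠ Π_V` may be identified with the fibre product of `Π_{U_X} ↠ Π`
  with `Π_V ↪ Π`" and is "recovered from `Π_U ↠ Π_D` by forming the fibre product with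
  `Π_V ↪ Π_D`": the identification of the two preimages of `Π_V` … -/
  glue : ↥(PiV.comap proj.arith.toMonoidHom) ≃*
    ↥((PiV.map toCore.arith.toMonoidHom).comap projU.arith.toMonoidHom)
  /-- … compatible with the two projections to `Π_V ⊆ Π_D` -/
  glue_comm : ∀ x : ↥(PiV.comap proj.arith.toMonoidHom),
    toCore.arith (proj.arith x) = projU.arith (glue x)
  /-- (iii)(b), uniqueness: an outer action of `Π'` trivial on `Π_V` (i.e. of "the finite group
  `Π/Π_V`") on `Π_{U_V}` lifting the conjugation action on `Π_V` along `Π_{U_V} ↠ Π_V` is UNIQUE -/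
  lifting_unique : ∀ ρ ρ' : E.arith →* Out ↥(PiV.comap proj.arith.toMonoidHom),
    PiV ≤ ρ.ker → PiV ≤ ρ'.ker →
    IsOuterLifting (proj.arith.toMonoidHom.comp (PiV.comap proj.arith.toMonoidHom).subtype) ρ →
    IsOuterLifting (proj.arith.toMonoidHom.comp (PiV.comap proj.arith.toMonoidHom).subtype) ρ' →
      ρ = ρ'
  /-- (iii)(b), reconstruction "by forming the `⋊^out`": `Π_{U_V}` has trivial centre, so that
  `Π_{U_X} = Π_{U_V} ⋊^out (Π_{U_X}/Π_{U_V})`, `Π_{U_X}/Π_{U_V} = Π'/Π_V`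
  (`conjProdQuot_injective`, `mem_range_conjProdQuot_iff`) -/
  center_PiUV_eq_bot : Subgroup.center ↥(PiV.comap proj.arith.toMonoidHom) = ⊥
  /-- (iii)(c) the cusps of `U_X` with their decomposition groups in `Π_{U_X}` ("the cuspidal
  decomposition groups of `Π_{U_X}` [cf. [AbsTopI], Lemma 4.5, (v)]") -/
  cusps : CuspidalData cuspUX

namespace EllipticCuspidalization

variable {E : FundamentalExtension.{u}} (C : EllipticCuspidalization E)

/-- `Π_{U_V} ⊆ Π_{U_X}`: the preimage of `Π_V` under the cuspidalization `Π_{U_X} ↠ Π'`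
(Cor 3.3 (iii), bracket in (b)). [cite: MochizukiAbsTopII2013, Cor 3.3 (iii)(b) p.69] -/
def PiUV : Subgroup C.cuspUX.arith := C.PiV.comap C.proj.arith.toMonoidHom

/-- The type-chain of the `Π`-chain of (iii)(a): "`⋏, ⋎, ⋏, •, …, •, ⋏, ⋎` — cf. Example 3.2,
(ii)". [cite: MochizukiAbsTopII2013, Cor 3.3 (iii)(a) p.68] -/
def typeChain : List ElementaryOp := Ex_3_2_ii_typeChain C.N

/-- **Cor 3.3 (iii) (c)** p. 69 (REAL on the output): "The decomposition groups of the closed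
points of `X` lying in the complement of `U_X` may be obtained as the images via `Π_{U_X} ↠ Π` of
the cuspidal decomposition groups of `Π_{U_X}`." [cite: MochizukiAbsTopII2013, Cor 3.3 (iii)(c) p.69] -/
def removedPointDecomposition (x : C.cusps.Cusp) : Subgroup E.arith :=
  (C.cusps.Dcusp x).map C.proj.arith.toMonoidHom

/-- The kernel of the cuspidalization `Π_{U_X} ↠ Π'` is contained in `Π_{U_V}` (so inner
automorphisms by kernel elements are inner on `Π_{U_V}`: the outer action of `Π'/Π_V` on `Π_{U_V}`
of (iii)(b) is well defined). [cite: MochizukiAbsTopII2013, Cor 3.3 (iii)(b) p.69] -/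
theorem ker_proj_le_PiUV : C.proj.arith.toMonoidHom.ker ≤ C.PiUV := by
  intro x hx
  rw [MonoidHom.mem_ker] at hx
  change C.proj.arith.toMonoidHom x ∈ C.PiV
  rw [hx]
  exact one_mem _

/-- `Π_{U_V}` is normal in `Π_{U_X}` (preimage of the normal subgroup `Π_V`).
[cite: MochizukiAbsTopII2013, Cor 3.3 (iii)(b) p.69] -/
instance normal_PiUV : C.PiUV.Normal := by
  haveI := C.normal_PiV
  exact Subgroup.Normal.comap inferInstance _

/-- (iii)(b) made explicit (PROVED from `center_PiUV_eq_bot`): `Π_{U_X}` embeds in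
`Aut(Π_{U_V}) × Π_{U_X}/Π_{U_V}` with image `Π_{U_V} ⋊^out (Π_{U_X}/Π_{U_V})`.
[cite: MochizukiAbsTopII2013, Cor 3.3 (iii)(b) p.69] -/
theorem conjProdQuot_PiUV_injective : Function.Injective (conjProdQuot C.PiUV) :=
  conjProdQuot_injective C.PiUV C.center_PiUV_eq_bot

/-- The decomposition group of a removed point is the image of a subgroup of `Π_{U_X}`, hence is
contained in the image of `proj` (bookkeeping lemma for consumers of (c)).
[cite: MochizukiAbsTopII2013, Cor 3.3 (iii)(c) p.69] -/
theorem removedPointDecomposition_le_range (x : C.cusps.Cusp) :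
    C.removedPointDecomposition x ≤ C.proj.arith.toMonoidHom.range :=
  Subgroup.map_le_range _ _

end EllipticCuspidalization

/-! ### Remark 3.3.2 -/

/-- **Remark 3.3.2** p. 69: "when `k` is an MLF or an NF, the subgroup `Δ ⊆ Π` admits a purely
group-theoretic characterization [cf. [AbsTopI], Theorem 2.6, (v), (vi)]. Thus, [...] the
various group-theoretic reconstruction algorithms described in the statement of Corollary 3.3
may be thought of as being applied not to the extension `1 → Δ → Π → G → 1`, but rather to the
single profinite group `Π`."  Typed as the group-theoretic content invoked, for a CLASS `𝒦` of
extensions (those of hyperbolic orbicurves over MLFs, resp. NFs — [AbsTopI] Thm 2.6 (v)(vi),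
abc-iut-L4-t4's node): every isomorphism of the profinite groups `Π` of two members of `𝒦`
carries `Δ` onto `Δ`. [cite: MochizukiAbsTopII2013, Rmk 3.3.2 p.69] -/
def Rmk_3_3_2 (𝒦 : Set FundamentalExtension.{u}) : Prop :=
  ∀ E ∈ 𝒦, ∀ F ∈ 𝒦, ∀ φ : E.arith ≃ₜ* F.arith, E.geom.map φ.toMonoidHom = F.geom

/-- Rmk 3.3.2 is inherited by sub-classes. [cite: MochizukiAbsTopII2013, Rmk 3.3.2 p.69] -/
theorem Rmk_3_3_2.mono {𝒦 𝒦' : Set FundamentalExtension.{u}} (h : 𝒦' ⊆ 𝒦) (H : Rmk_3_3_2 𝒦) :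
    Rmk_3_3_2 𝒦' :=
  fun E hE F hF φ => H E (h hE) F (h hF) φ

/-! ### Remark 3.3.3 (p. 69) — recorded, no claim
`Rmk_3_3_3 : recorded, no claim.`  "One verifies immediately that Corollary 3.3 admits a 'tempered
version', when the base field `k` is an MLF [cf. [AbsTopI], Theorem 4.12, (i)]. We leave the
routine details to the reader."  The tempered output structure has the same shape as
`EllipticCuspidalization` over the tempered-`π₁` interface of abc-iut-L3-t2
(`Literature.AnabelianGeometry.SemiGraphs.TemperedAnabelian`); no further claim is printed, none
is typed. [cite: MochizukiAbsTopII2013, Rmk 3.3.3 p.69] -/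

end Literature.AnabelianGeometry.AbsoluteAnabelian.AbsTopII
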